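import Literature.Analysis.FluidPDE.PassiveVectorLionsExtract
import Literature.Analysis.FunctionSpaces.TorusSpectralWeakDerivative
import HarnessLib

/-!
# The graph closure of the divergence-free tests in `L²(μ_T; (ψ, ∇ψ))`: weak gradients and
# divergence-free slices (extraction for the variable-tensor Lions solution)

Analysis/FluidPDE proof-support file (everything proved; no definitions, no named facts). Companion of
`PassiveVectorLionsExtract` for the GRAPH space used by the variable-tensor existence theory
(`PassiveVectorVarTensorLionsGraph`): the divergence-free space–time tests `ψ` on `T^d × [0,T)` are
embedded as `p ↦ (ψ(p), ∂₁ψ(p), …, ∂_dψ(p))` into `L²(μ_T; G)`, `G = Π₂_{o ∈ Option d} ℝ^d`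
(coordinate `none` = the value, `some c` = the `c`-th partial derivative), `μ_T = dt|_{(0,T)} ⊗ dx`.
For `U` in the CLOSED SPAN of these embeddings we prove, slice-wise for a.e. `t ∈ (0,T)`:

* `ae_hasWeakPartialDeriv_of_mem_closure_graph` — **the components `x ↦ U(t,x)_{some c}` are the weak
  partial derivatives (`Torus.HasWeakPartialDeriv c`) of the value `x ↦ U(t,x)_{none}`**, all in
  `L²(T^d)`: the closed linear relations `∫_{μ_T} η(t)(∂_cθ(x) U_{none,i} + θ(x) U_{some c,i}) = 0`
  (`η ∈ C_c^∞(0,T)`, `θ = Re(z e_{-k})`) hold on the embedded tests by integration by parts on `T^d`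
  and pass to the closure; du Bois-Reymond in `t`, then the Fourier characterisation of weak
  derivatives (`Torus.hasWeakPartialDeriv_of_mFourierCoeff`, Grafakos Prop. 3.2.6 (8));
* `ae_isWeaklyDivFree_of_mem_closure_graph` — the value slices are weakly divergence free (the value
  projection maps the graph closure into the `L²` closure of `PassiveVectorLionsExtract`).

This is the `L²(0,T; H¹(T^d))` regularity WITH an honest weak gradient of Lions–Magenes 1972, Chap. 3,
Thm. 1.1 / §4.3 (solution in `L²(0,T; V)`, `V = H¹_σ`), in the tree's measure-theoretic vocabulary.

* `memLp_two_of_continuous_slab` — continuous fields on `ℝ × T^d` are in `L²(μ_T)` (any codomain);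
* `inner_eq_zero_of_mem_closure_graph` — continuous functionals vanishing on the embedded tests vanish on
  the closure;
* `mFourierCoeff_eq_of_forall_pairing` — `ĝ(k) = 2πi k_c f̂(k)` from the two real pairings with
  `θ_z = Re(z e_{-k})`, `z ∈ {1, i}`;
* `integral_partialDeriv_mul_apply_eq_neg` — `∫ ∂_cθ ψᵢ = -∫ θ (∂_cψ)ᵢ` for smooth `ψ`, `θ`.

## Mathlib / tree search

Tree: `PassiveVectorLionsExtract` (`inner_eq_zero_of_mem_closure`, `ae_isWeaklyDivFree_of_mem_closure`,
the `θ_{k,z}` tests), `TorusSpectralWeakDerivative.hasWeakPartialDeriv_of_mFourierCoeff`,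
`TorusTrigPoly` (`partialDeriv_re_trigPoly`, `mFourierCoeff_eq_integral_volume`),
`IsSmooth.hasWeakPartialDeriv` + `integral_partialDeriv_eq_zero_holds`. Mathlib: `MemLp.eval_piLp`,
`eval_integral_piLp`, `PiLp.proj`, `ContinuousLinearMap.compLpL`,
`IsOpen.ae_eq_zero_of_integral_contDiff_smul_eq_zero`.

## References

* J.-L. Lions, E. Magenes, *Non-homogeneous boundary value problems and applications* I (1972), Chap. 3,
  Thm. 1.1, §4.3. [`LionsMagenes1972`]
* L. Grafakos, *Classical Fourier Analysis*, 3rd ed. (2014), Prop. 3.2.6 (8). [`Grafakos2014`]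
* L. C. Evans, *Partial Differential Equations*, 2nd ed. (2010), §5.2.1. [`Evans2010`]
-/

noncomputable section

open MeasureTheory Set Filter Function TopologicalSpace
open scoped ENNReal NNReal InnerProductSpace Topology ContDiff

namespace Literature.Analysis.FluidPDE

namespace Torus

variable {d : Type*} [Fintype d] [DecidableEq d]

/-! ## Generic tools on the slab `(0,T) × T^d` -/

omit [DecidableEq d] in
/-- Points of `(0,T) × T^d` have their time coordinate in `(0,T)`, a.e. [folklore] -/
private theorem ae_fst_mem_Ioo_prod₃₁ (T : ℝ) :
    ∀ᵐ p : ℝ × UnitAddTorus d ∂(((volume : Measure ℝ).restrict (Ioo 0 T)).prod volume), p.1 ∈ Ioo 0 T :=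
  (Measure.quasiMeasurePreserving_fst (μ := (volume : Measure ℝ).restrict (Ioo 0 T))
    (ν := (volume : Measure (UnitAddTorus d)))).ae (ae_restrict_mem measurableSet_Ioo)

omit [DecidableEq d] in
/-- A continuous field on `ℝ × T^d` (any normed codomain) is in `L²(μ_T)`: it is bounded on the compact
`[0,T] × T^d` (Lions–Magenes 1972, Chap. 3 §4.3: the test fields are in the pivot space).
[cite: LionsMagenes1972, Chap. 3 §4.3] -/
theorem memLp_two_of_continuous_slab {T : ℝ} {F : Type*} [NormedAddCommGroup F]
    {V : ℝ × UnitAddTorus d → F} (hV : Continuous V) :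
    MemLp V 2 (((volume : Measure ℝ).restrict (Ioo 0 T)).prod volume) := by
  obtain ⟨C, hC⟩ := (isCompact_Icc.prod isCompact_univ).exists_bound_of_continuousOn
    (s := Icc (0 : ℝ) T ×ˢ (univ : Set (UnitAddTorus d))) hV.continuousOn
  have htop : MemLp V ∞ (((volume : Measure ℝ).restrict (Ioo 0 T)).prod volume) := by
    refine memLp_top_of_bound hV.aestronglyMeasurable C ?_
    filter_upwards [ae_fst_mem_Ioo_prod₃₁ (d := d) T] with p hp
    exact hC p ⟨Ioo_subset_Icc_self hp, mem_univ _⟩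
  exact htop.mono_exponent le_top

omit [DecidableEq d] in
/-- Slices of an `L²(μ_T)` function (any codomain) are in `L²(T^d)` for a.e. `t ∈ (0,T)` (Tonelli).
[folklore] -/
private theorem ae_memLp_two_slice_prod₃₁ {T : ℝ} {F : Type*} [NormedAddCommGroup F]
    {v : ℝ × UnitAddTorus d → F}
    (hv : MemLp v 2 (((volume : Measure ℝ).restrict (Ioo 0 T)).prod (volume : Measure (UnitAddTorus d)))) :
    ∀ᵐ t ∂(volume.restrict (Ioo 0 T)), MemLp (fun x => v (t, x)) 2 volume := by
  have hm := hv.1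
  have hfin : ∫⁻ p, ‖v p‖ₑ ^ 2 ∂(((volume : Measure ℝ).restrict (Ioo 0 T)).prod (volume : Measure (UnitAddTorus d))) < ⊤ := by
    have h2 := lintegral_rpow_enorm_lt_top_of_eLpNorm_lt_top two_ne_zero ENNReal.ofNat_ne_top hv.eLpNorm_lt_top
    simp only [ENNReal.toReal_ofNat, ENNReal.rpow_two] at h2
    exact h2
  have hmeas : AEMeasurable (fun p : ℝ × UnitAddTorus d => ‖v p‖ₑ ^ 2)
      (((volume : Measure ℝ).restrict (Ioo 0 T)).prod (volume : Measure (UnitAddTorus d))) := hm.enorm.pow_const 2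
  rw [lintegral_prod _ hmeas] at hfin
  filter_upwards [ae_lt_top' hmeas.lintegral_prod_right' hfin.ne, hm.prodMk_left] with t ht hmt
  refine ⟨hmt, ?_⟩
  rw [eLpNorm_eq_lintegral_rpow_enorm_toReal two_ne_zero ENNReal.ofNat_ne_top, ENNReal.toReal_ofNat]
  have e : ∫⁻ x, ‖v (t, x)‖ₑ ^ (2 : ℝ) = ∫⁻ x, ‖v (t, x)‖ₑ ^ 2 := lintegral_congr fun x => by rw [ENNReal.rpow_two]
  rw [e]
  exact ENNReal.rpow_lt_top_of_nonneg (by norm_num) ht.ne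

omit [DecidableEq d] in
/-- A continuous real function times an integrable one is integrable on `T^d`. [folklore] -/
private theorem integrable_continuous_mul₃₁ {φ : UnitAddTorus d → ℝ} (hφ : Continuous φ)
    {f : UnitAddTorus d → ℝ} (hf : Integrable f volume) : Integrable (fun x => φ x * f x) volume := by
  obtain ⟨C, hC⟩ := (isCompact_univ.image hφ).isBounded.exists_norm_le
  exact hf.bdd_mul hφ.aestronglyMeasurable (Eventually.of_forall fun x => hC _ ⟨x, mem_univ _, rfl⟩)

/-! ## Functionals on the graph closure -/

/-- **Continuous linear functionals `⟪·, G⟫_{L²(μ_T; Π₂ ℝ^d)}` vanishing on the graph embeddings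
`(ψ, ∇ψ)` of the divergence-free tests vanish on the closed span** (the kernel is a closed submodule).
[cite: LionsMagenes1972, Chap. 3 §4.3] -/
theorem inner_eq_zero_of_mem_closure_graph {T : ℝ}
    {G : ℝ × UnitAddTorus d → PiLp 2 (fun _ : Option d => EuclideanSpace ℝ d)}
    (hG : MemLp G 2 (((volume : Measure ℝ).restrict (Ioo 0 T)).prod (volume : Measure (UnitAddTorus d))))
    (hG0 : ∀ ψ : ℝ → UnitAddTorus d → EuclideanSpace ℝ d, FunctionSpaces.Torus.IsSpaceTimeTest T ψ →
      FunctionSpaces.Torus.IsDivFreeTest ψ →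
      ∫ p, ⟪WithLp.toLp 2 (fun o : Option d =>
          o.elim (ψ p.1 p.2) (fun c => FunctionSpaces.Torus.partialDeriv c (ψ p.1) p.2)), G p⟫_ℝ
        ∂(((volume : Measure ℝ).restrict (Ioo 0 T)).prod volume) = 0)
    {U : Lp (PiLp 2 (fun _ : Option d => EuclideanSpace ℝ d)) 2
      (((volume : Measure ℝ).restrict (Ioo 0 T)).prod (volume : Measure (UnitAddTorus d)))}
    (hU : U ∈ (Submodule.span ℝ {f : Lp (PiLp 2 (fun _ : Option d => EuclideanSpace ℝ d)) 2
            (((volume : Measure ℝ).restrict (Ioo 0 T)).prod (volume : Measure (UnitAddTorus d))) |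
          ∃ ψ : ℝ → UnitAddTorus d → EuclideanSpace ℝ d, FunctionSpaces.Torus.IsSpaceTimeTest T ψ ∧
            FunctionSpaces.Torus.IsDivFreeTest ψ ∧
            (f : ℝ × UnitAddTorus d → PiLp 2 (fun _ : Option d => EuclideanSpace ℝ d))
              =ᵐ[((volume : Measure ℝ).restrict (Ioo 0 T)).prod volume]
              fun p => WithLp.toLp 2 (fun o : Option d =>
                o.elim (ψ p.1 p.2) (fun c => FunctionSpaces.Torus.partialDeriv c (ψ p.1) p.2))}).topologicalClosure) :
    ∫ p, ⟪(U : ℝ × UnitAddTorus d → PiLp 2 (fun _ : Option d => EuclideanSpace ℝ d)) p, G p⟫_ℝ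
      ∂(((volume : Measure ℝ).restrict (Ioo 0 T)).prod volume) = 0 := by
  set μ : Measure (ℝ × UnitAddTorus d) := ((volume : Measure ℝ).restrict (Ioo 0 T)).prod volume with hμ
  set Λ : Lp (PiLp 2 (fun _ : Option d => EuclideanSpace ℝ d)) 2 μ →L[ℝ] ℝ := innerSL ℝ (hG.toLp G) with hΛ
  have hΛf : ∀ f : Lp (PiLp 2 (fun _ : Option d => EuclideanSpace ℝ d)) 2 μ,
      Λ f = ∫ p, ⟪(f : ℝ × UnitAddTorus d → PiLp 2 (fun _ : Option d => EuclideanSpace ℝ d)) p, G p⟫_ℝ ∂μ := by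
    intro f
    rw [hΛ, innerSL_apply_apply, MeasureTheory.L2.inner_def]
    refine integral_congr_ae ?_
    filter_upwards [hG.coeFn_toLp] with p hp
    rw [hp, real_inner_comm]
  have hker : (Submodule.span ℝ {f : Lp (PiLp 2 (fun _ : Option d => EuclideanSpace ℝ d)) 2 μ |
      ∃ ψ : ℝ → UnitAddTorus d → EuclideanSpace ℝ d, FunctionSpaces.Torus.IsSpaceTimeTest T ψ ∧
        FunctionSpaces.Torus.IsDivFreeTest ψ ∧
        (f : ℝ × UnitAddTorus d → PiLp 2 (fun _ : Option d => EuclideanSpace ℝ d)) =ᵐ[μ]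
          fun p => WithLp.toLp 2 (fun o : Option d =>
            o.elim (ψ p.1 p.2) (fun c => FunctionSpaces.Torus.partialDeriv c (ψ p.1) p.2))}).topologicalClosure ≤
      LinearMap.ker (Λ : Lp (PiLp 2 (fun _ : Option d => EuclideanSpace ℝ d)) 2 μ →ₗ[ℝ] ℝ) := by
    refine Submodule.topologicalClosure_minimal _ (Submodule.span_le.2 ?_) (Λ.isClosed_ker)
    rintro f ⟨ψ, hψ, hdiv, hf⟩
    show Λ f = 0
    rw [hΛf, integral_congr_ae (show (fun p => ⟪(f : ℝ × UnitAddTorus d → PiLp 2 (fun _ : Option d => EuclideanSpace ℝ d)) p, G p⟫_ℝ) =ᵐ[μ]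
      fun p => ⟪WithLp.toLp 2 (fun o : Option d =>
          o.elim (ψ p.1 p.2) (fun c => FunctionSpaces.Torus.partialDeriv c (ψ p.1) p.2)), G p⟫_ℝ from by
        filter_upwards [hf] with p hp; rw [hp])]
    exact hG0 ψ hψ hdiv
  have h := hker hU
  rw [LinearMap.mem_ker] at h
  rw [← hΛf]
  exact h

/-! ## The value slices are weakly divergence free -/

/-- **The value projection maps the graph closure into the `L²` closure of the tests**: for `U` in the
closed span of the graph embeddings, `p ↦ U(p)_{none}` (as `compLpL` of the coordinate projection) lies in
the closed span of the divergence-free tests in `L²(μ_T; ℝ^d)` (continuity of the projection).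
[cite: LionsMagenes1972, Chap. 3 §4.3] -/
theorem compLpL_proj_none_mem_closure {T : ℝ}
    {U : Lp (PiLp 2 (fun _ : Option d => EuclideanSpace ℝ d)) 2
      (((volume : Measure ℝ).restrict (Ioo 0 T)).prod (volume : Measure (UnitAddTorus d)))}
    (hU : U ∈ (Submodule.span ℝ {f : Lp (PiLp 2 (fun _ : Option d => EuclideanSpace ℝ d)) 2
            (((volume : Measure ℝ).restrict (Ioo 0 T)).prod (volume : Measure (UnitAddTorus d))) |
          ∃ ψ : ℝ → UnitAddTorus d → EuclideanSpace ℝ d, FunctionSpaces.Torus.IsSpaceTimeTest T ψ ∧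
            FunctionSpaces.Torus.IsDivFreeTest ψ ∧
            (f : ℝ × UnitAddTorus d → PiLp 2 (fun _ : Option d => EuclideanSpace ℝ d))
              =ᵐ[((volume : Measure ℝ).restrict (Ioo 0 T)).prod volume]
              fun p => WithLp.toLp 2 (fun o : Option d =>
                o.elim (ψ p.1 p.2) (fun c => FunctionSpaces.Torus.partialDeriv c (ψ p.1) p.2))}).topologicalClosure) :
    ContinuousLinearMap.compLpL 2 (((volume : Measure ℝ).restrict (Ioo 0 T)).prod (volume : Measure (UnitAddTorus d)))
        (PiLp.proj (𝕜 := ℝ) 2 (fun _ : Option d => EuclideanSpace ℝ d) none) U ∈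
      (Submodule.span ℝ {f : Lp (EuclideanSpace ℝ d) 2
            (((volume : Measure ℝ).restrict (Ioo 0 T)).prod (volume : Measure (UnitAddTorus d))) |
          ∃ ψ : ℝ → UnitAddTorus d → EuclideanSpace ℝ d, FunctionSpaces.Torus.IsSpaceTimeTest T ψ ∧
            FunctionSpaces.Torus.IsDivFreeTest ψ ∧
            (f : ℝ × UnitAddTorus d → EuclideanSpace ℝ d) =ᵐ[((volume : Measure ℝ).restrict (Ioo 0 T)).prod volume]
              uncurry ψ}).topologicalClosure := by
  set P : Lp (PiLp 2 (fun _ : Option d => EuclideanSpace ℝ d)) 2 (((volume : Measure ℝ).restrict (Ioo 0 T)).prod (volume : Measure (UnitAddTorus d))) →L[ℝ] Lp (EuclideanSpace ℝ d) 2 (((volume : Measure ℝ).restrict (Ioo 0 T)).prod (volume : Measure (UnitAddTorus d))) :=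
    ContinuousLinearMap.compLpL 2 (((volume : Measure ℝ).restrict (Ioo 0 T)).prod (volume : Measure (UnitAddTorus d))) (PiLp.proj (𝕜 := ℝ) 2 (fun _ : Option d => EuclideanSpace ℝ d) none) with hP
  set SG : Set (Lp (PiLp 2 (fun _ : Option d => EuclideanSpace ℝ d)) 2 (((volume : Measure ℝ).restrict (Ioo 0 T)).prod (volume : Measure (UnitAddTorus d)))) :=
    {f | ∃ ψ : ℝ → UnitAddTorus d → EuclideanSpace ℝ d, FunctionSpaces.Torus.IsSpaceTimeTest T ψ ∧
      FunctionSpaces.Torus.IsDivFreeTest ψ ∧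
      (f : ℝ × UnitAddTorus d → PiLp 2 (fun _ : Option d => EuclideanSpace ℝ d)) =ᵐ[(((volume : Measure ℝ).restrict (Ioo 0 T)).prod (volume : Measure (UnitAddTorus d)))]
        fun p => WithLp.toLp 2 (fun o : Option d =>
          o.elim (ψ p.1 p.2) (fun c => FunctionSpaces.Torus.partialDeriv c (ψ p.1) p.2))} with hSG
  set SE : Set (Lp (EuclideanSpace ℝ d) 2 (((volume : Measure ℝ).restrict (Ioo 0 T)).prod (volume : Measure (UnitAddTorus d)))) :=
    {f | ∃ ψ : ℝ → UnitAddTorus d → EuclideanSpace ℝ d, FunctionSpaces.Torus.IsSpaceTimeTest T ψ ∧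
      FunctionSpaces.Torus.IsDivFreeTest ψ ∧ (f : ℝ × UnitAddTorus d → EuclideanSpace ℝ d) =ᵐ[(((volume : Measure ℝ).restrict (Ioo 0 T)).prod (volume : Measure (UnitAddTorus d)))] uncurry ψ}
    with hSE
  -- `P` maps the generating set into the generating set
  have hPS : ∀ f ∈ SG, P f ∈ SE := by
    rintro f ⟨ψ, hψ, hdiv, hf⟩
    refine ⟨ψ, hψ, hdiv, ?_⟩
    filter_upwards [ContinuousLinearMap.coeFn_compLpL (PiLp.proj (𝕜 := ℝ) 2 (fun _ : Option d => EuclideanSpace ℝ d) none) f,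
      hf] with p hp hq
    rw [hP, hp, hq]
    rfl
  -- hence the span into the span
  have hPspan : ∀ f ∈ Submodule.span ℝ SG, P f ∈ Submodule.span ℝ SE := by
    intro f hf
    induction hf using Submodule.span_induction with
    | mem g hg => exact Submodule.subset_span (hPS g hg)
    | zero => rw [map_zero]; exact zero_mem _
    | add g g' _ _ hg hg' => rw [map_add]; exact add_mem hg hg'
    | smul a g _ hg => rw [map_smul]; exact Submodule.smul_mem _ a hg
  -- and the closure into the closure (continuity of `P`)
  have hU' : (U : Lp (PiLp 2 (fun _ : Option d => EuclideanSpace ℝ d)) 2 (((volume : Measure ℝ).restrict (Ioo 0 T)).prod (volume : Measure (UnitAddTorus d)))) ∈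
      closure ((Submodule.span ℝ SG : Submodule ℝ _) : Set (Lp (PiLp 2 (fun _ : Option d => EuclideanSpace ℝ d)) 2 (((volume : Measure ℝ).restrict (Ioo 0 T)).prod (volume : Measure (UnitAddTorus d))))) := by
    rw [← Submodule.topologicalClosure_coe]
    exact hU
  have h1 : P U ∈ closure (P '' ((Submodule.span ℝ SG : Submodule ℝ _) :
      Set (Lp (PiLp 2 (fun _ : Option d => EuclideanSpace ℝ d)) 2 (((volume : Measure ℝ).restrict (Ioo 0 T)).prod (volume : Measure (UnitAddTorus d)))))) :=
    image_closure_subset_closure_image P.continuous ⟨U, hU', rfl⟩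
  have h2 : P '' ((Submodule.span ℝ SG : Submodule ℝ _) : Set (Lp (PiLp 2 (fun _ : Option d => EuclideanSpace ℝ d)) 2 (((volume : Measure ℝ).restrict (Ioo 0 T)).prod (volume : Measure (UnitAddTorus d))))) ⊆
      ((Submodule.span ℝ SE : Submodule ℝ _) : Set (Lp (EuclideanSpace ℝ d) 2 (((volume : Measure ℝ).restrict (Ioo 0 T)).prod (volume : Measure (UnitAddTorus d))))) := by
    rintro f ⟨g, hg, rfl⟩
    exact hPspan g hg
  have h3 := closure_mono h2 h1
  rw [← Submodule.topologicalClosure_coe] at h3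
  exact h3

/-- **The value slices of an element of the graph closure are weakly divergence free**: for `U` in the
closed span of the graph embeddings of the divergence-free tests, for a.e. `t ∈ (0,T)` the slice
`x ↦ U(t,x)_{none}` is in `L²(T^d)` and weakly divergence free (`PassiveVectorLionsExtract` applied to the
value projection). [cite: LionsMagenes1972, Chap. 3 §4.3] -/
theorem ae_isWeaklyDivFree_of_mem_closure_graph {T : ℝ}
    {U : Lp (PiLp 2 (fun _ : Option d => EuclideanSpace ℝ d)) 2
      (((volume : Measure ℝ).restrict (Ioo 0 T)).prod (volume : Measure (UnitAddTorus d)))}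
    (hU : U ∈ (Submodule.span ℝ {f : Lp (PiLp 2 (fun _ : Option d => EuclideanSpace ℝ d)) 2
            (((volume : Measure ℝ).restrict (Ioo 0 T)).prod (volume : Measure (UnitAddTorus d))) |
          ∃ ψ : ℝ → UnitAddTorus d → EuclideanSpace ℝ d, FunctionSpaces.Torus.IsSpaceTimeTest T ψ ∧
            FunctionSpaces.Torus.IsDivFreeTest ψ ∧
            (f : ℝ × UnitAddTorus d → PiLp 2 (fun _ : Option d => EuclideanSpace ℝ d))
              =ᵐ[((volume : Measure ℝ).restrict (Ioo 0 T)).prod volume]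
              fun p => WithLp.toLp 2 (fun o : Option d =>
                o.elim (ψ p.1 p.2) (fun c => FunctionSpaces.Torus.partialDeriv c (ψ p.1) p.2))}).topologicalClosure) :
    ∀ᵐ t ∂(volume.restrict (Ioo 0 T)),
      MemLp (fun x => (U : ℝ × UnitAddTorus d → PiLp 2 (fun _ : Option d => EuclideanSpace ℝ d)) (t, x) none) 2 volume ∧
        FunctionSpaces.Torus.IsWeaklyDivFree
          (fun x => (U : ℝ × UnitAddTorus d → PiLp 2 (fun _ : Option d => EuclideanSpace ℝ d)) (t, x) none) := by
  set v : Lp (EuclideanSpace ℝ d) 2 (((volume : Measure ℝ).restrict (Ioo 0 T)).prod (volume : Measure (UnitAddTorus d))) := ContinuousLinearMap.compLpL 2 (((volume : Measure ℝ).restrict (Ioo 0 T)).prod (volume : Measure (UnitAddTorus d)))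
    (PiLp.proj (𝕜 := ℝ) 2 (fun _ : Option d => EuclideanSpace ℝ d) none) U with hv
  have h := ae_isWeaklyDivFree_of_mem_closure (compLpL_proj_none_mem_closure hU)
  have hcoe : (v : ℝ × UnitAddTorus d → EuclideanSpace ℝ d) =ᵐ[(((volume : Measure ℝ).restrict (Ioo 0 T)).prod (volume : Measure (UnitAddTorus d)))]
      fun p => (U : ℝ × UnitAddTorus d → PiLp 2 (fun _ : Option d => EuclideanSpace ℝ d)) p none := by
    filter_upwards [ContinuousLinearMap.coeFn_compLpL (PiLp.proj (𝕜 := ℝ) 2 (fun _ : Option d => EuclideanSpace ℝ d) none) U]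
      with p hp
    rw [hv, hp]
    rfl
  have hslice : ∀ᵐ t ∂(volume.restrict (Ioo 0 T)), ∀ᵐ x ∂(volume : Measure (UnitAddTorus d)),
      (v : ℝ × UnitAddTorus d → EuclideanSpace ℝ d) (t, x) =
        (U : ℝ × UnitAddTorus d → PiLp 2 (fun _ : Option d => EuclideanSpace ℝ d)) (t, x) none :=
    Measure.ae_ae_of_ae_prod hcoe
  filter_upwards [h, hslice] with t ht hts
  refine ⟨ht.1.ae_eq hts, fun θ hθ => ?_⟩
  refine (integral_congr_ae ?_).trans (ht.2 θ hθ)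
  filter_upwards [hts] with x hx
  rw [hx]

/-! ## Weak gradients: Fourier coefficients from the real one-mode pairings -/

/-- **`ĝ(k) = 2πi k_c f̂(k)` from the two real pairings**: if real integrable `f`, `g` on `T^d` satisfy
`∫ ∂_cθ_z f = -∫ θ_z g` for the scalar tests `θ_z = Re(z e_{-k})`, `z ∈ {1, i}`, then the `k`-th Fourier
coefficient of `g` is `2πi k_c` times that of `f` (Grafakos 2014, Prop. 3.2.6 (8), read backwards; the
computation of `PassiveVectorLionsExtract.sum_mul_mFourierCoeff_eq_zero_of_forall_pairing`).
[cite: Grafakos2014, Prop. 3.2.6 (8)] -/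
theorem mFourierCoeff_eq_of_forall_pairing {f g : UnitAddTorus d → ℝ} (hf : Integrable f volume)
    (hg : Integrable g volume) (c : d) (k : d → ℤ)
    (h : ∀ z : ℂ, z = 1 ∨ z = Complex.I →
      ∫ x, FunctionSpaces.Torus.partialDeriv c
          (fun y : UnitAddTorus d => (FunctionSpaces.Torus.trigPoly {-k} (fun _ => z) y).re) x * f x =
        -∫ x, (FunctionSpaces.Torus.trigPoly {-k} (fun _ => z) x).re * g x) :
    UnitAddTorus.mFourierCoeff (fun x => (g x : ℂ)) k =
      (2 * Real.pi * Complex.I * (k c) : ℂ) * UnitAddTorus.mFourierCoeff (fun x => (f x : ℂ)) k := by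
  have hfC : Integrable (fun x => (f x : ℂ)) volume := Complex.ofRealCLM.integrable_comp hf
  have hgC : Integrable (fun x => (g x : ℂ)) volume := Complex.ofRealCLM.integrable_comp hg
  have hbd : ∀ x : UnitAddTorus d, ‖UnitAddTorus.mFourier (-k) x‖ ≤ 1 := fun x =>
    ((UnitAddTorus.mFourier (-k)).norm_coe_le_norm x).trans_eq UnitAddTorus.mFourier_norm
  have hIf : Integrable (fun x => UnitAddTorus.mFourier (-k) x * (f x : ℂ)) volume :=
    hfC.bdd_mul (UnitAddTorus.mFourier (-k)).continuous.aestronglyMeasurable (Eventually.of_forall hbd)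
  have hIg : Integrable (fun x => UnitAddTorus.mFourier (-k) x * (g x : ℂ)) volume :=
    hgC.bdd_mul (UnitAddTorus.mFourier (-k)).continuous.aestronglyMeasurable (Eventually.of_forall hbd)
  have hA : ∫ x, UnitAddTorus.mFourier (-k) x * (f x : ℂ) = UnitAddTorus.mFourierCoeff (fun x => (f x : ℂ)) k := by
    rw [FunctionSpaces.Torus.mFourierCoeff_eq_integral_volume]
    rfl
  have hB : ∫ x, UnitAddTorus.mFourier (-k) x * (g x : ℂ) = UnitAddTorus.mFourierCoeff (fun x => (g x : ℂ)) k := by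
    rw [FunctionSpaces.Torus.mFourierCoeff_eq_integral_volume]
    rfl
  set A : ℂ := UnitAddTorus.mFourierCoeff (fun x => (f x : ℂ)) k with hAdef
  set B : ℂ := UnitAddTorus.mFourierCoeff (fun x => (g x : ℂ)) k with hBdef
  set κ : ℂ := (2 * Real.pi * Complex.I * (k c) : ℂ) with hκ
  have key : ∀ z : ℂ, z = 1 ∨ z = Complex.I → (z * (B - κ * A)).re = 0 := by
    intro z hz
    have h0 := h z hz
    have hL : ∀ x, FunctionSpaces.Torus.partialDeriv c
        (fun y : UnitAddTorus d => (FunctionSpaces.Torus.trigPoly {-k} (fun _ => z) y).re) x * f x =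
        (z * (-κ) * (UnitAddTorus.mFourier (-k) x * (f x : ℂ))).re := by
      intro x
      rw [FunctionSpaces.Torus.partialDeriv_re_trigPoly, FunctionSpaces.Torus.trigPoly_apply, Finset.sum_singleton,
        ← Complex.re_mul_ofReal]
      congr 1
      simp only [Pi.neg_apply, Int.cast_neg, smul_eq_mul, hκ]
      ring
    have hR : ∀ x, (FunctionSpaces.Torus.trigPoly {-k} (fun _ => z) x).re * g x =
        (z * (UnitAddTorus.mFourier (-k) x * (g x : ℂ))).re := by
      intro x
      rw [FunctionSpaces.Torus.trigPoly_apply, Finset.sum_singleton, ← Complex.re_mul_ofReal]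
      congr 1
      simp only [smul_eq_mul]
      ring
    simp_rw [hL, hR] at h0
    have h1 := integral_re (hIf.const_mul (z * (-κ)))
    have h2 := integral_re (hIg.const_mul z)
    simp only [RCLike.re_to_complex] at h1 h2
    rw [h1, h2, integral_const_mul, integral_const_mul, hA, hB] at h0
    have e : z * (B - κ * A) = z * B + z * (-κ) * A := by ring
    rw [e, Complex.add_re, h0]
    ring
  have h1 := key 1 (Or.inl rfl)
  have h2 := key Complex.I (Or.inr rfl)
  rw [one_mul] at h1
  rw [Complex.I_mul_re] at h2
  have hW : B - κ * A = 0 := Complex.ext h1 (neg_eq_zero.1 h2)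
  exact sub_eq_zero.1 hW

/-- **`∫ ∂_cθ ψᵢ = -∫ θ (∂_cψ)ᵢ`** for a smooth field `ψ` and a smooth scalar `θ` on `T^d` (the
`i`-th coordinate of `IsSmooth.hasWeakPartialDeriv`: classical derivatives are weak derivatives,
Evans §5.2.1). [cite: Evans2010, §5.2.1] -/
theorem integral_partialDeriv_mul_apply_eq_neg {ψ : UnitAddTorus d → EuclideanSpace ℝ d}
    (hψ : FunctionSpaces.Torus.IsSmooth ψ) {θ : UnitAddTorus d → ℝ} (hθ : FunctionSpaces.Torus.IsSmooth θ)
    (c i : d) :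
    ∫ x, FunctionSpaces.Torus.partialDeriv c θ x * ψ x i =
      -∫ x, θ x * (FunctionSpaces.Torus.partialDeriv c ψ x) i := by
  have hW := FunctionSpaces.Torus.IsSmooth.hasWeakPartialDeriv
    FunctionSpaces.Torus.integral_partialDeriv_eq_zero_holds hψ c θ hθ
  have hL : ∀ j, Integrable (fun x => (FunctionSpaces.Torus.partialDeriv c θ x • ψ x) j) volume := fun j =>
    ((hθ.partialDeriv c).integrable_smul hψ.integrable).eval_piLp j
  have hR : ∀ j, Integrable (fun x => (θ x • FunctionSpaces.Torus.partialDeriv c ψ x) j) volume := fun j =>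
    (hθ.integrable_smul (hψ.partialDeriv c).integrable).eval_piLp j
  have h := congrArg (fun v : EuclideanSpace ℝ d => v i) hW
  simp only at h
  rw [eval_integral_piLp hL i, WithLp.ofLp_neg, Pi.neg_apply, eval_integral_piLp hR i] at h
  simpa only [PiLp.smul_apply, smul_eq_mul] using h

/-! ## Weak gradients of elements of the graph closure -/

/-- **The derivative components of an element of the graph closure are the weak partial derivatives of
its value, slice-wise.** For `U ∈ L²(μ_T; Π₂_{Option d} ℝ^d)` in the closed span of the graph embeddings
`(ψ, ∂₁ψ, …, ∂_dψ)` of the divergence-free space–time tests: for a.e. `t ∈ (0,T)` the slice `U(t,·)` is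
in `L²(T^d)` and, for every `c`, `x ↦ U(t,x)_{some c}` is a weak `c`-th partial derivative of
`x ↦ U(t,x)_{none}` (`Torus.HasWeakPartialDeriv`). Constraint functionals
`⟪·, η(t)(∂_cθ e_i ⊕_c θ e_i)⟫_{L²(μ_T)}` (integration by parts on the embedded tests), du Bois-Reymond in
`t`, the Fourier characterisation of weak derivatives. [cite: LionsMagenes1972, Chap. 3 Thm. 1.1 and §4.3]
[cite: Grafakos2014, Prop. 3.2.6 (8)] -/
theorem ae_hasWeakPartialDeriv_of_mem_closure_graph {T : ℝ}
    {U : Lp (PiLp 2 (fun _ : Option d => EuclideanSpace ℝ d)) 2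
      (((volume : Measure ℝ).restrict (Ioo 0 T)).prod (volume : Measure (UnitAddTorus d)))}
    (hU : U ∈ (Submodule.span ℝ {f : Lp (PiLp 2 (fun _ : Option d => EuclideanSpace ℝ d)) 2
            (((volume : Measure ℝ).restrict (Ioo 0 T)).prod (volume : Measure (UnitAddTorus d))) |
          ∃ ψ : ℝ → UnitAddTorus d → EuclideanSpace ℝ d, FunctionSpaces.Torus.IsSpaceTimeTest T ψ ∧
            FunctionSpaces.Torus.IsDivFreeTest ψ ∧
            (f : ℝ × UnitAddTorus d → PiLp 2 (fun _ : Option d => EuclideanSpace ℝ d))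
              =ᵐ[((volume : Measure ℝ).restrict (Ioo 0 T)).prod volume]
              fun p => WithLp.toLp 2 (fun o : Option d =>
                o.elim (ψ p.1 p.2) (fun c => FunctionSpaces.Torus.partialDeriv c (ψ p.1) p.2))}).topologicalClosure) :
    ∀ᵐ t ∂(volume.restrict (Ioo 0 T)),
      MemLp (fun x => (U : ℝ × UnitAddTorus d → PiLp 2 (fun _ : Option d => EuclideanSpace ℝ d)) (t, x)) 2 volume ∧
        ∀ c, FunctionSpaces.Torus.HasWeakPartialDeriv c
          (fun x => (U : ℝ × UnitAddTorus d → PiLp 2 (fun _ : Option d => EuclideanSpace ℝ d)) (t, x) none)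
          (fun x => (U : ℝ × UnitAddTorus d → PiLp 2 (fun _ : Option d => EuclideanSpace ℝ d)) (t, x) (some c)) := by
  haveI : IsFiniteMeasure (((volume : Measure ℝ).restrict (Ioo 0 T)).prod (volume : Measure (UnitAddTorus d))) := by infer_instance
  set Uf : ℝ × UnitAddTorus d → PiLp 2 (fun _ : Option d => EuclideanSpace ℝ d) :=
    (U : ℝ × UnitAddTorus d → PiLp 2 (fun _ : Option d => EuclideanSpace ℝ d)) with hUf
  have hUL2 : MemLp Uf 2 (((volume : Measure ℝ).restrict (Ioo 0 T)).prod (volume : Measure (UnitAddTorus d))) := Lp.memLp U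
  have hcoord : ∀ (o : Option d) (i : d), Integrable (fun p => Uf p o i) (((volume : Measure ℝ).restrict (Ioo 0 T)).prod (volume : Measure (UnitAddTorus d))) := fun o i =>
    ((hUL2.integrable one_le_two).eval_piLp o).eval_piLp i
  -- the scalar tests `θ_{k,b} = Re (z_b e_{-k})`, `z_true = 1`, `z_false = i`
  set zOf : Bool → ℂ := fun b => if b then 1 else Complex.I with hzOf
  set θ : (d → ℤ) × Bool → UnitAddTorus d → ℝ := fun kb y =>
    (FunctionSpaces.Torus.trigPoly {-kb.1} (fun _ => zOf kb.2) y).re with hθ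
  have hθs : ∀ kb, FunctionSpaces.Torus.IsSmooth (θ kb) := fun kb => FunctionSpaces.Torus.isSmooth_re_trigPoly _ _
  have hθc : ∀ kb, Continuous (θ kb) := fun kb => (hθs kb).continuous
  have hθdc : ∀ kb c, Continuous (FunctionSpaces.Torus.partialDeriv c (θ kb)) := fun kb c =>
    ((hθs kb).partialDeriv c).continuous
  -- the pairings `F_{kb,i,c}(t) = ∫ ∂_cθ U_{none,i} + θ U_{some c,i}`
  set F : ((d → ℤ) × Bool) × d × d → ℝ → ℝ := fun q t =>
    ∫ x, (FunctionSpaces.Torus.partialDeriv q.2.2 (θ q.1) x * Uf (t, x) none q.2.1 +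
      θ q.1 x * Uf (t, x) (some q.2.2) q.2.1) with hF
  -- the space–time integrand is integrable
  have hInt : ∀ q : ((d → ℤ) × Bool) × d × d, Integrable (fun p : ℝ × UnitAddTorus d =>
      FunctionSpaces.Torus.partialDeriv q.2.2 (θ q.1) p.2 * Uf p none q.2.1 +
        θ q.1 p.2 * Uf p (some q.2.2) q.2.1) (((volume : Measure ℝ).restrict (Ioo 0 T)).prod (volume : Measure (UnitAddTorus d))) := by
    intro q
    obtain ⟨C₁, hC₁⟩ := (isCompact_univ.image (hθdc q.1 q.2.2)).isBounded.exists_norm_le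
    obtain ⟨C₂, hC₂⟩ := (isCompact_univ.image (hθc q.1)).isBounded.exists_norm_le
    refine ((hcoord none q.2.1).bdd_mul ((hθdc q.1 q.2.2).comp continuous_snd).aestronglyMeasurable
      (Eventually.of_forall fun p => hC₁ _ ⟨p.2, mem_univ _, rfl⟩)).add
      ((hcoord (some q.2.2) q.2.1).bdd_mul ((hθc q.1).comp continuous_snd).aestronglyMeasurable
      (Eventually.of_forall fun p => hC₂ _ ⟨p.2, mem_univ _, rfl⟩))
  have hFint : ∀ q, IntegrableOn (F q) (Ioo 0 T) := fun q => (hInt q).integral_prod_left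
  -- `∫ g F_q = 0` for smooth `g` compactly supported in `(0,T)`
  have hgF : ∀ q, ∀ g : ℝ → ℝ, ContDiff ℝ ∞ g → HasCompactSupport g → tsupport g ⊆ Ioo 0 T →
      ∫ t, g t • F q t = 0 := by
    rintro ⟨kb, i, c⟩ g hg hgc hgT
    -- the constraint field
    set Gf : ℝ × UnitAddTorus d → PiLp 2 (fun _ : Option d => EuclideanSpace ℝ d) := fun p =>
      WithLp.toLp 2 (fun o : Option d => o.elim
        ((g p.1 * FunctionSpaces.Torus.partialDeriv c (θ kb) p.2) • EuclideanSpace.single i (1 : ℝ))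
        (fun c' => (g p.1 * θ kb p.2 * (if c' = c then (1 : ℝ) else 0)) • EuclideanSpace.single i (1 : ℝ)))
      with hGf
    have hGc : Continuous Gf := by
      refine (PiLp.continuous_toLp 2 _).comp (continuous_pi fun o => ?_)
      cases o with
      | none =>
        exact ((hg.continuous.comp continuous_fst).mul ((hθdc kb c).comp continuous_snd)).smul continuous_const
      | some c' =>
        exact (((hg.continuous.comp continuous_fst).mul ((hθc kb).comp continuous_snd)).mul
          continuous_const).smul continuous_const
    have hGm : MemLp Gf 2 (((volume : Measure ℝ).restrict (Ioo 0 T)).prod (volume : Measure (UnitAddTorus d))) := memLp_two_of_continuous_slab hGc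
    -- the pointwise pairing
    have hpair : ∀ (V : PiLp 2 (fun _ : Option d => EuclideanSpace ℝ d)) (p : ℝ × UnitAddTorus d),
        ⟪V, Gf p⟫_ℝ = g p.1 * (FunctionSpaces.Torus.partialDeriv c (θ kb) p.2 * V none i +
          θ kb p.2 * V (some c) i) := by
      intro V p
      rw [PiLp.inner_apply, Fintype.sum_option]
      simp only [hGf, PiLp.toLp_apply, Option.elim, real_inner_smul_right, EuclideanSpace.inner_single_right,
        conj_trivial, one_mul, mul_ite, mul_one, mul_zero, ite_mul, zero_mul, Finset.sum_ite_eq',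
        Finset.mem_univ, if_true]
      ring
    -- it vanishes on the graph embeddings of the tests (integration by parts on `T^d`)
    have hG0 : ∀ ψ : ℝ → UnitAddTorus d → EuclideanSpace ℝ d, FunctionSpaces.Torus.IsSpaceTimeTest T ψ →
        FunctionSpaces.Torus.IsDivFreeTest ψ →
        ∫ p, ⟪WithLp.toLp 2 (fun o : Option d =>
            o.elim (ψ p.1 p.2) (fun c => FunctionSpaces.Torus.partialDeriv c (ψ p.1) p.2)), Gf p⟫_ℝ ∂(((volume : Measure ℝ).restrict (Ioo 0 T)).prod (volume : Measure (UnitAddTorus d))) = 0 := by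
      intro ψ hψ _
      have hpt : ∀ p : ℝ × UnitAddTorus d, ⟪WithLp.toLp 2 (fun o : Option d =>
          o.elim (ψ p.1 p.2) (fun c => FunctionSpaces.Torus.partialDeriv c (ψ p.1) p.2)), Gf p⟫_ℝ =
          g p.1 * (FunctionSpaces.Torus.partialDeriv c (θ kb) p.2 * ψ p.1 p.2 i +
            θ kb p.2 * (FunctionSpaces.Torus.partialDeriv c (ψ p.1) p.2) i) := by
        intro p
        rw [hpair]
        rfl
      simp_rw [hpt]
      have hcont : Continuous (fun p : ℝ × UnitAddTorus d => g p.1 *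
          (FunctionSpaces.Torus.partialDeriv c (θ kb) p.2 * ψ p.1 p.2 i +
            θ kb p.2 * (FunctionSpaces.Torus.partialDeriv c (ψ p.1) p.2) i)) := by
        have h1 : Continuous (fun p : ℝ × UnitAddTorus d => ψ p.1 p.2 i) :=
          (PiLp.continuous_apply 2 _ i).comp hψ.continuous_uncurry
        have h2 : Continuous (fun p : ℝ × UnitAddTorus d => (FunctionSpaces.Torus.partialDeriv c (ψ p.1) p.2) i) :=
          (PiLp.continuous_apply 2 _ i).comp (show Continuous (uncurry fun t x => FunctionSpaces.Torus.partialDeriv c (ψ t) x) from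
            hψ.continuous_uncurry_lineDeriv (EuclideanSpace.single c 1))
        exact (hg.continuous.comp continuous_fst).mul
          ((((hθdc kb c).comp continuous_snd).mul h1).add (((hθc kb).comp continuous_snd).mul h2))
      have hint : Integrable (fun p : ℝ × UnitAddTorus d => g p.1 *
          (FunctionSpaces.Torus.partialDeriv c (θ kb) p.2 * ψ p.1 p.2 i +
            θ kb p.2 * (FunctionSpaces.Torus.partialDeriv c (ψ p.1) p.2) i)) (((volume : Measure ℝ).restrict (Ioo 0 T)).prod (volume : Measure (UnitAddTorus d))) :=
        (memLp_two_of_continuous_slab hcont).integrable one_le_two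
      rw [integral_prod _ hint]
      have hslice : ∀ t, ∫ x, g t * (FunctionSpaces.Torus.partialDeriv c (θ kb) x * ψ t x i +
          θ kb x * (FunctionSpaces.Torus.partialDeriv c (ψ t) x) i) = 0 := by
        intro t
        have hψt : FunctionSpaces.Torus.IsSmooth (ψ t) := hψ.isSmooth_slice t
        have I1 : Integrable (fun x => FunctionSpaces.Torus.partialDeriv c (θ kb) x * ψ t x i) volume :=
          integrable_continuous_mul₃₁ (hθdc kb c) (hψt.integrable.eval_piLp i)
        have I2 : Integrable (fun x => θ kb x * (FunctionSpaces.Torus.partialDeriv c (ψ t) x) i) volume :=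
          integrable_continuous_mul₃₁ (hθc kb) ((hψt.partialDeriv c).integrable.eval_piLp i)
        rw [integral_const_mul, integral_add I1 I2, integral_partialDeriv_mul_apply_eq_neg hψt (hθs kb) c i,
          neg_add_cancel, mul_zero]
      have e : (fun t => ∫ x, g (t, x).1 * (FunctionSpaces.Torus.partialDeriv c (θ kb) (t, x).2 * ψ (t, x).1 (t, x).2 i +
          θ kb (t, x).2 * (FunctionSpaces.Torus.partialDeriv c (ψ (t, x).1) (t, x).2) i)) = fun _ => 0 := by
        funext t
        exact hslice t
      rw [e, integral_zero]
    -- hence on `U`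
    have h0 := inner_eq_zero_of_mem_closure_graph hGm hG0 hU
    have hpt : ∀ p : ℝ × UnitAddTorus d, ⟪Uf p, Gf p⟫_ℝ =
        g p.1 * (FunctionSpaces.Torus.partialDeriv c (θ kb) p.2 * Uf p none i + θ kb p.2 * Uf p (some c) i) :=
      fun p => hpair _ p
    have hint : Integrable (fun p : ℝ × UnitAddTorus d =>
        g p.1 * (FunctionSpaces.Torus.partialDeriv c (θ kb) p.2 * Uf p none i + θ kb p.2 * Uf p (some c) i)) (((volume : Measure ℝ).restrict (Ioo 0 T)).prod (volume : Measure (UnitAddTorus d))) := by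
      obtain ⟨C, hC⟩ := (hg.continuous.norm.bddAbove_range_of_hasCompactSupport hgc.norm)
      refine (hInt (kb, i, c)).bdd_mul ((hg.continuous.comp continuous_fst).aestronglyMeasurable)
        (Eventually.of_forall fun p => hC ⟨p.1, rfl⟩)
    rw [show (fun p => ⟪(U : ℝ × UnitAddTorus d → PiLp 2 (fun _ : Option d => EuclideanSpace ℝ d)) p, Gf p⟫_ℝ) =
      fun p => g p.1 * (FunctionSpaces.Torus.partialDeriv c (θ kb) p.2 * Uf p none i + θ kb p.2 * Uf p (some c) i)
      from funext hpt, integral_prod _ hint] at h0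
    have e1 : ∫ t in Ioo 0 T, ∫ x, g (t, x).1 * (FunctionSpaces.Torus.partialDeriv c (θ kb) (t, x).2 * Uf ((t, x).1, (t, x).2) none i +
        θ kb (t, x).2 * Uf ((t, x).1, (t, x).2) (some c) i) = ∫ t in Ioo 0 T, g t • F (kb, i, c) t := by
      refine integral_congr_ae (ae_of_all _ fun t => ?_)
      simp only [hF, integral_const_mul, smul_eq_mul]
    rw [e1] at h0
    rw [← h0]
    symm
    refine setIntegral_eq_integral_of_forall_compl_eq_zero fun t ht => ?_
    rw [image_eq_zero_of_notMem_tsupport (fun h => ht (hgT h)), zero_smul]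
  -- du Bois-Reymond: `F_q = 0` a.e. on `(0,T)`, for every `q`
  have hae : ∀ q, ∀ᵐ t ∂(volume.restrict (Ioo 0 T)), F q t = 0 := by
    intro q
    have h := (isOpen_Ioo (a := (0:ℝ)) (b := T)).ae_eq_zero_of_integral_contDiff_smul_eq_zero
      (hFint q).locallyIntegrableOn (hgF q)
    rw [ae_restrict_iff' measurableSet_Ioo]
    exact h
  rw [← ae_all_iff] at hae
  filter_upwards [hae, ae_memLp_two_slice_prod₃₁ hUL2] with t ht hL2
  refine ⟨hL2, fun c => ?_⟩
  -- the slice data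
  have hv : MemLp (fun x => Uf (t, x) none) 2 volume := hL2.eval_piLp none
  have hw : MemLp (fun x => Uf (t, x) (some c)) 2 volume := hL2.eval_piLp (some c)
  set gC : d → UnitAddTorus d → ℂ := fun i x => ((Uf (t, x) (some c) i : ℝ) : ℂ) with hgC
  have hgCm : ∀ i, MemLp (gC i) 2 volume := fun i => Complex.ofRealCLM.comp_memLp' (hw.eval_piLp i)
  have hcoeff : ∀ i (k : d → ℤ), UnitAddTorus.mFourierCoeff (gC i) k =
      (2 * Real.pi * Complex.I * (k c) : ℂ) * UnitAddTorus.mFourierCoeff (fun x => (Uf (t, x) none i : ℂ)) k := by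
    intro i k
    have I1 : ∀ b, Integrable (fun x => FunctionSpaces.Torus.partialDeriv c (θ (k, b)) x * Uf (t, x) none i) volume :=
      fun b => integrable_continuous_mul₃₁ (hθdc (k, b) c) ((hv.integrable one_le_two).eval_piLp i)
    have I2 : ∀ b, Integrable (fun x => θ (k, b) x * Uf (t, x) (some c) i) volume :=
      fun b => integrable_continuous_mul₃₁ (hθc (k, b)) ((hw.integrable one_le_two).eval_piLp i)
    have key : ∀ b, ∫ x, FunctionSpaces.Torus.partialDeriv c (θ (k, b)) x * Uf (t, x) none i =
        -∫ x, θ (k, b) x * Uf (t, x) (some c) i := by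
      intro b
      have h0 := ht ((k, b), i, c)
      simp only [hF] at h0
      rw [integral_add (I1 b) (I2 b)] at h0
      linarith
    refine mFourierCoeff_eq_of_forall_pairing ((hv.integrable one_le_two).eval_piLp i)
      ((hw.integrable one_le_two).eval_piLp i) c k fun z hz => ?_
    rcases hz with rfl | rfl
    · have h1 := key true
      simp only [hθ, hzOf, if_true] at h1
      exact h1
    · have h1 := key false
      simp only [hθ, hzOf] at h1
      exact h1
  have hW := FunctionSpaces.Torus.hasWeakPartialDeriv_of_mFourierCoeff hv hgCm c hcoeff
  have e : (fun x => ∑ i, (gC i x).re • EuclideanSpace.single i (1 : ℝ)) = fun x => Uf (t, x) (some c) := by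
    funext x
    ext j
    simp [hgC, Finset.sum_apply, Pi.single_apply, WithLp.ofLp_sum]
  rw [e] at hW
  exact hW

end Torus

end Literature.Analysis.FluidPDE

end
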